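import Summits.ABC.IUTFork.Repair.RHRound4ConstraintRequirements
import Summits.ABC.IUTFork.Repair.RHRound4ConstraintRequirementsB
import Summits.ABC.IUTFork.Repair.RHRound4ConstraintRequirementsC
import Summits.ABC.IUTFork.Repair.RHSigmaLicenceInvariance
import HarnessLib

/-!
# R-H ROUND 4, row R4-7 — KERNEL FACES for the ODD constraint sheets O-10 (V1, the BOX `0 ≤ ω ≤ 1`) · O-12 (V3, the HONEST CONE) ·
# O-14 (V5, PLACE AGGREGATION / self-financing, kept@1): each sheet's census word made kernel-exact

abc-iut cell, rung LADDER-ABC:A2.RESCUE.H; seat abc-iut-rh2-q2-eq (GEN 11; KEY `wake/KEY-abc-iut-rh2-q2-eq-R4FACE-ODD.md`, abc-iut-rh-lead g5 (OPENINGS-CENSUS pen)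
2026-08-27T14:54:40Z under director-abc g6-D15 (4) «ODD → rh2-q2-eq, EVEN → rh2-w-1»; referee rh-ref-1 g15). Sheets of record: V1 `ROUND4/R4-7-V1-abc-iut-rh3-gen-1.md` v1.4
56c4325f45e18dfc (PASS rh-ref-1 14:39:02Z) · V3 `ROUND4/R4-7-V3-abc-iut-rh3-gen-3.md` 81bb2eeef91cce3d (PASS 14:36:35Z) · V5 `ROUND4/R4-7-V5-abc-iut-rh3-gen-5.md` 4bfc176e2f725617
(PASS 14:34:51Z); rh-ref-2 CONCUR ×3 14:50:51Z. GENRE: PROOF-ONLY (0 definitions, 0 `Prop` facts, no `instance` / `notation` / `sorry` / `native_decide`; `decide` · `norm_num`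
· `omega` over explicit parameters, one-line logic otherwise) over LANDED vocabulary cited BY NAME, never restated: abc-iut-L5-t8 ★ p539032 `RHRound4ConstraintRequirements` (V1:
`BoxRow`, `NettingRow`, `V1_deficitFloor`, T-V1 `kept_le_surplusValue_of_le_one_on_licensed`, `V2_B0'_netWithinPlace`) · ★ p539557 `…B` (V3: `V3_B1_coneRelaxedBy`,
`V3_B2_containerConsistent`) · ★ p540469 `…C` (V5: `reweightedMass`, `reweightedExcess`, `V5_R1_reweightedCor312`, `V5_R2_droppedShareBound`); ★ p532994 `RHHeightScaling` (`price`,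
`demand`, `ExponentAtMost`, `NegExponent`, `DoorAt`, `PriceBounded`); `DiffPricedHull.HullCellδ`; this lineage's p479556 / p480491 / p476178 (`cellDeficit`, `signedRemainder`).
Per sheet: (α) the (c)-numbers the referee re-derived, as exact identities; (β) residual requirement ⟹ census word (exponent / no door / E unchanged) BY NAME; (γ) the inertness
identities the sheets printed.
HONEST FRAMING / GUARDS: numbers, not adjectives; every KILLED word is KILLED AS TYPED at OUR interface over claim-tagged requirement `Prop`s in OUR cell currency (hypotheses,
never Literature facts; FROZEN FACT-LIST f75a60bac22efdb6 untouched, 0 new Props); the worked place is ONE place of ONE datum (FREY133 `p = 7`, `l = 107`: `e = 1605`, `m_q = 210`,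
`δ = 1604`, `R_in = 268`, `R_out = −4472`) — an arithmetic witness, nothing more; the height ray `m_q ↦ s·m_q` is the WINDOW MODEL of FINAL (1)(e); located ≠ adjudicated;
typed ≠ proved; computed ≠ proved; audited ≠ endorsed; no side on [IUTchIII] Cor 3.12 / Rmk 3.9.x / [IUTchIV] Thm 1.10 or on any author (D-0045); nothing here asserts that
abc is proved or refuted. [claim: Mochizuki2012, status: disputed] for every IUT locution.
[cite: Mochizuki2012, IUTchIII Cor. 3.12 p. 173–174, Prop. 3.9 (i)–(iii) p. 116–117; IUTchIV Prop. 1.2 p. 10, Thm. 1.10 Step (v)–(viii) p. 27–30, Cor. 2.2 p. 40–42]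
-/

noncomputable section
open Finset
namespace Summit.ABC.IUTFork.Repair.RH.Round4ConstraintFacesOdd
open Summit.ABC.IUTFork Summit.ABC.IUTFork.Thm311 Summit.ABC.IUTFork.Cor312 Summit.ABC.IUTFork.Cor312.Setting Summit.ABC.IUTFork.Cor312Vol Literature.IUT.LogThetaLattice
  Summit.ABC.IUTFork.Repair.RH.Round4ConstraintRequirements Summit.ABC.IUTFork.Repair.RH.HeightScaling Summit.ABC.IUTFork.Repair.RH.DiffPricedHull
  Summit.ABC.IUTFork.Repair.RH.SigmaLicence Summit.ABC.IUTFork.Repair.RH.SigmaMass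

/-! ## §V1 (census O-10) — the BOX `0 ≤ ω(c) ≤ 1`. Word of record: KILLED-BY-CONSISTENCY (V1 = print, `ω ≡ 1`; V1⁺ relaxed = bookkeeping `U(m) = m·value`, door-idle
off deficit-floor cells, exponent unchanged; V1⁺ removed = value `∈ {0, +∞}`; V1⁻ dropped = LIC value unchanged, MEETS(1) invariant); residual R-10 `V1_deficitFloor` (p539032). -/

section V1Table

variable {ι 𝕜 : Type*} [Field 𝕜] [LinearOrder 𝕜] [IsStrictOrderedRing 𝕜]

/-- **c-U(m) HOMOGENEITY, box side** (sheet «(P) is positively homogeneous in ω ⇒ value(box m) = m·value(box 1) EXACTLY … ω ↦ ω/m is a bijection of feasible sets»):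
`ω` lies in the `m`-box iff `ω/m` lies in the box of record `BoxRow` (p539032 §0). [folklore] -/
theorem boxRow_boxScale_iff {s : Finset ι} {ω : ι → 𝕜} {m : 𝕜} (hm : 0 < m) :
    (∀ c ∈ s, 0 ≤ ω c ∧ ω c ≤ m) ↔ BoxRow s (fun c => ω c / m) := by
  refine forall₂_congr fun c _ => and_congr ?_ ?_
  · rw [le_div_iff₀ hm, zero_mul]
  · rw [div_le_one hm]

/-- **c-U(m) HOMOGENEITY, netting side**: the netting row `NettingRow` (p539032) is invariant under `ω ↦ ω/m`, `m > 0`. [folklore] -/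
theorem nettingRow_boxScale_iff {s : Finset ι} {ŝ ω : ι → 𝕜} {m : 𝕜} (hm : 0 < m) :
    NettingRow s ŝ (fun c => ω c / m) ↔ NettingRow s ŝ ω := by
  unfold NettingRow
  have h : ∑ c ∈ s, ω c / m * ŝ c = (∑ c ∈ s, ω c * ŝ c) / m := by rw [Finset.sum_div]; exact Finset.sum_congr rfl fun c _ => by ring
  rw [h, le_div_iff₀ hm, zero_mul]

omit [IsStrictOrderedRing 𝕜] in
/-- **c-U(m) HOMOGENEITY, value side**: kept(`ω`) `= m ×` kept(`ω/m`) — «μ ↦ m·μ, MEETS(μ₀) ⟺ μ ≥ μ₀/m», so the bed's `U(2)`/`U(3)` columns (133·133·132·110 /133,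
79·79·79·79 /79, …) are the record columns read at `μ₀/m`: «demand bought m times, not coverage». [folklore] -/
theorem kept_boxScale {s : Finset ι} (t ω : ι → 𝕜) {m : 𝕜} (hm : 0 < m) :
    ∑ c ∈ s, ω c * t c = m * ∑ c ∈ s, ω c / m * t c := by
  rw [Finset.mul_sum]
  exact Finset.sum_congr rfl fun c _ => by field_simp

omit [LinearOrder 𝕜] [IsStrictOrderedRing 𝕜] in
/-- Bookkeeping for the recession ray: a two-point weight `N·(𝟙_{c₁} + λ·𝟙_{c₂})` pairs with `g` to `N·(g c₁ + λ·g c₂)`. [folklore] -/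
theorem sum_twoPoint [DecidableEq ι] {s : Finset ι} {c₁ c₂ : ι} (hc₁ : c₁ ∈ s) (hc₂ : c₂ ∈ s) {N lam : 𝕜} {g : ι → 𝕜} :
    ∑ c ∈ s, N * ((if c = c₁ then 1 else 0) + lam * (if c = c₂ then 1 else 0)) * g c = N * (g c₁ + lam * g c₂) := by
  simp only [mul_add, add_mul, Finset.sum_add_distrib, ite_mul, mul_ite, zero_mul, mul_one, mul_zero, Finset.sum_ite_eq', if_pos hc₁, if_pos hc₂]
  ring

/-- **c-U(∞), V1⁺ REMOVED — RAY CRITERION, unbounded half** (sheet «value = +∞ iff (∃ cell with t > 0 ∧ ŝ ≥ 0) ∨ ((∃ cell with t > 0) ∧ (∃ cell with ŝ > 0))»; bed: UNBOUNDED on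
133/133 · 79/79 · 482/482): under either disjunct every bound `B` is beaten by a netting-feasible `ω ≥ 0` (recession ray `N·(𝟙_{c₁} + λ·𝟙_{c₂})`); V1⁺ is the ONLY bound. [folklore] -/
theorem kept_unbounded_of_ray [DecidableEq ι] {s : Finset ι} {t ŝ : ι → 𝕜} (ht : ∀ c ∈ s, 0 ≤ t c)
    (h : (∃ c ∈ s, 0 < t c ∧ 0 ≤ ŝ c) ∨ ((∃ c ∈ s, 0 < t c) ∧ (∃ c ∈ s, 0 < ŝ c))) (B : 𝕜) :
    ∃ ω : ι → 𝕜, (∀ c ∈ s, 0 ≤ ω c) ∧ NettingRow s ŝ ω ∧ B < ∑ c ∈ s, ω c * t c := by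
  obtain ⟨c₁, hc₁, ht₁, c₂, hc₂, lam, hlam, hfin⟩ :
      ∃ c₁ ∈ s, 0 < t c₁ ∧ ∃ c₂ ∈ s, ∃ lam : 𝕜, 0 ≤ lam ∧ 0 ≤ ŝ c₁ + lam * ŝ c₂ := by
    rcases h with ⟨c, hc, htc, hsc⟩ | ⟨⟨c, hc, htc⟩, ⟨c', hc', hsc'⟩⟩
    · exact ⟨c, hc, htc, c, hc, 0, le_rfl, by rw [zero_mul, add_zero]; exact hsc⟩
    · refine ⟨c, hc, htc, c', hc', max (-ŝ c) 0 / ŝ c', div_nonneg (le_max_right _ _) hsc'.le, ?_⟩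
      rw [div_mul_cancel₀ _ hsc'.ne']
      rcases le_total 0 (ŝ c) with h0 | h0 <;> [rw [max_eq_right (by linarith)]; rw [max_eq_left (by linarith)]] <;> linarith
  have hN0 : 0 ≤ |B| / t c₁ + 1 := by positivity
  have hNB : B < (|B| / t c₁ + 1) * t c₁ := by rw [add_mul, div_mul_cancel₀ _ ht₁.ne', one_mul]; linarith [le_abs_self B]
  refine ⟨fun c => (|B| / t c₁ + 1) * ((if c = c₁ then 1 else 0) + lam * (if c = c₂ then 1 else 0)), ?_, ?_, ?_⟩
  · intro c _
    refine mul_nonneg hN0 (add_nonneg ?_ (mul_nonneg hlam ?_)) <;> split_ifs <;> norm_num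
  · unfold NettingRow
    rw [sum_twoPoint hc₁ hc₂]
    exact mul_nonneg hN0 hfin
  · rw [sum_twoPoint hc₁ hc₂]
    have h2 : 0 ≤ (|B| / t c₁ + 1) * (lam * t c₂) := mul_nonneg hN0 (mul_nonneg hlam (ht c₂ hc₂))
    nlinarith

/-- **c-U(∞) — RAY CRITERION, bounded half**: in the complementary case (every positive-mass cell is a deficit cell, AND no positive-mass cell OR no strictly-slack cell)
every netting-feasible `ω ≥ 0` keeps NOTHING — with V1⁺ removed the value of (P) is `∈ {0, +∞}`, exactly as the sheet says. [folklore] -/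
theorem kept_eq_zero_of_no_ray {s : Finset ι} {t ŝ ω : ι → 𝕜} (ht : ∀ c ∈ s, 0 ≤ t c)
    (hdef : ∀ c ∈ s, 0 < t c → ŝ c < 0) (hno : (∀ c ∈ s, t c ≤ 0) ∨ (∀ c ∈ s, ŝ c ≤ 0))
    (h0 : ∀ c ∈ s, 0 ≤ ω c) (hnet : NettingRow s ŝ ω) : ∑ c ∈ s, ω c * t c = 0 := by
  obtain hT | hS := hno
  · exact Finset.sum_eq_zero fun c hc => by rw [le_antisymm (hT c hc) (ht c hc), mul_zero]
  · have hle : ∀ c ∈ s, ω c * ŝ c ≤ 0 := fun c hc => mul_nonpos_iff.mpr (Or.inl ⟨h0 c hc, hS c hc⟩)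
    have hterm : ∀ c ∈ s, ω c * ŝ c = 0 := (Finset.sum_eq_zero_iff_of_nonpos hle).mp (le_antisymm (Finset.sum_nonpos hle) hnet)
    refine Finset.sum_eq_zero fun c hc => ?_
    rcases (ht c hc).eq_or_lt with h0t | hpos
    · rw [← h0t, mul_zero]
    · rcases mul_eq_zero.mp (hterm c hc) with hω | hŝ
      · rw [hω, zero_mul]
      · exact absurd hŝ (hdef c hc hpos).ne

/-- **c-L, V1⁻ DROPPED at tier LIC — VALUE UNCHANGED** (sheet B4 = typer ask T-V1, PROVED by abc-iut-L5-t8 as `kept_le_surplusValue_of_le_one_on_licensed`, p539032, BY NAME):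
with NO lower bound on `ω` and `ω ≤ 1`, a netting-feasible scheme on a LIC table (`ŝ = −t` off the licence) keeps `≤ min(M, mass(σ) + C_σ)` — both record bounds survive. [folklore] -/
theorem lic_value_le_min_of_no_lower_bound {s : Finset ι} {t ŝ ω : ι → 𝕜} (ht : ∀ c ∈ s, 0 ≤ t c)
    (hunit : ∀ c ∈ s, ŝ c < 0 → ŝ c = -t c) (h1 : ∀ c ∈ s, ω c ≤ 1) (hnet : NettingRow s ŝ ω) :
    ∑ c ∈ s, ω c * t c ≤ min (∑ c ∈ s, t c) (∑ c ∈ s.filter (fun c => 0 ≤ ŝ c), (t c + ŝ c)) :=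
  le_min (Finset.sum_le_sum fun c hc => by nlinarith [ht c hc, h1 c hc])
    (kept_le_surplusValue_of_le_one_on_licensed ht hunit (fun c hc _ => h1 c hc) hnet)

/-- **c-L at the AS-POSED tier (record only) — THE WORKED PLACE, EXACT** (FREY133 `p = 7`, `l = 107`; rh-ref-1 «CHARACTER-FOR-CHARACTER»): `r_w = t₅₃/(−ŝ₅₃) = 589,680/247,827
= 196,560/82,609`, `Σ_j ŝ_j = Π − M = −1,332,482`, `K⁻_w = M_w + r_w·Σ_j ŝ_j = 622,586,857,620/82,609 = 0.70389·M` (boxed `0.67979·M`), `ω₅₃ = −1,084,655/247,827 = −4.377`. [folklore] -/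
theorem workedPlace_negativeWeight_value :
    (589680 : ℚ) / 247827 = 196560 / 82609 ∧
    (10707060 : ℚ) + 589680 / 247827 * (-1332482) = 622586857620 / 82609 ∧
    (10707060 : ℤ) * 82609 - 196560 * 1332482 = 622586857620 ∧
    -((-1332482 : ℚ) - (-247827)) / (-247827) = -1084655 / 247827 ∧
    (70388 : ℚ) / 10 ^ 5 < 622586857620 / 82609 / 10707060 ∧ (622586857620 : ℚ) / 82609 / 10707060 < 70389 / 10 ^ 5 ∧
    (-4377 : ℚ) / 10 ^ 3 < -1084655 / 247827 ∧ (-1084655 : ℚ) / 247827 < -4376 / 10 ^ 3 := by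
  norm_num

/-- **c-L — «MEETS(μ₀ = 1) is INVARIANT under L on every bed»** (sheet «exact: `K⁻_w < MM_w ⟺ Σ_j ŝ_j < 0 ⟺ K_w < MM_w` — negative weights redistribute a place's deficit onto
its worst-ratio label, they never remove it»): for `r_w > 0`, `M_w + r_w·Σŝ < M_w ⟺ Σŝ < 0`. [folklore] -/
theorem meets_one_invariant_under_negative_weights {M r S : 𝕜} (hr : 0 < r) : M + r * S < M ↔ S < 0 := by
  rw [add_lt_iff_neg_left, mul_neg_iff]
  exact ⟨fun h => h.elim (fun h => h.2) fun h => absurd h.1 (not_lt.mpr hr.le), fun h => Or.inl ⟨hr, h⟩⟩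

end V1Table

section V1Kernel

variable {T : ThetaIndex} {S : Situation T} {P : Cor312.Setting S}

/-- **V1⁺ RELAXED is DOOR-IDLE off the deficit floor** (sheet B1/B2 «both halves of the box are free exactly on B1-cells, and nowhere else»; residual R-10 `V1_deficitFloor`,
p539032): on a deficit-floor cell the weighted door's loss term `(1 − ω)·(t − d)` VANISHES FOR EVERY `ω` — a weight `> 1` or `< 0` there moves nothing. [claim: Mochizuki2012, status: disputed] -/
theorem doorLoss_eq_zero_of_deficitFloor (H : BridgeHyps P) {c : Fin T.lstar × T.VQ} (h : V1_deficitFloor P c) (ω : ℝ) :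
    (1 - ω) * (cellTrivialCost P c - cellDeficit P c.1 c.2) = 0 := by
  rw [cellDeficit_eq_cellTrivialCost_of_deficitFloor H h, sub_self, mul_zero]

end V1Kernel

/-- **V1 on the HEIGHT AXIS — the exponent survives the box relaxation** (sheet c-K «U(m) multiplies kept mass and conceded mass alike by bookkeeping … the D2 exponent rows
(−1 EXACTLY for every box-feasible supplier) are unaffected»): rescaling a profile by `m ≥ 0` keeps `ExponentAtMost α` with constant `× m` (p532994). [folklore] -/
theorem exponentAtMost_boxScale {f : ℝ → ℝ} {α C m : ℝ} (hm : 0 ≤ m) (h : ExponentAtMost f α C) :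
    ExponentAtMost (fun s => m * f s) α (m * C) := fun s hs => by
  rw [mul_assoc]
  exact mul_le_mul_of_nonneg_left (h s hs) hm

/-- … hence a negative exponent survives (`NegExponent`, p532994) … [folklore] -/
theorem negExponent_boxScale {f : ℝ → ℝ} {m : ℝ} (hm : 0 ≤ m) (h : NegExponent f) : NegExponent (fun s => m * f s) :=
  let ⟨α, C, hα, hC, h⟩ := h; ⟨α, m * C, hα, mul_nonneg hm hC, exponentAtMost_boxScale hm h⟩

/-- … and NO DOOR opens (`not_doorAt_of_negExponent`, BY NAME): census O-10 «nothing here is a window supplier». [folklore] -/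
theorem not_doorAt_boxScale {f : ℝ → ℝ} {m : ℝ} (hm : 0 ≤ m) (h : NegExponent f) : ¬ DoorAt (fun s => m * f s) :=
  not_doorAt_of_negExponent (negExponent_boxScale hm h)

/-! ## §V3 (census O-12) — LICENSING / the HONEST CONE. Word of record: KILLED-BY-CONSISTENCY as typed beyond print's container; CONSISTENT-and-booked inside it (≤ tier EX);
exponent-inert (closes only at `x = 1` = the Statement); residual `∃ κ x, 0 < x ∧ x < 1 ∧ V3_B1_coneRelaxedBy P κ x` beyond the cap (p539557). -/

/-- **C5 · THE WORKED PLACE's integer cells, EXACT** (rh-ref-1 14:36:35Z «every digit reproduces»; p532994 `demand m j = (j²−1)·m`, `price = j·δ + (j+1)·(R_in − R_out) + ρ_j`):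
`margin₃₁ = +469` (`j₀ = 31`), `margin₃₂ = −6,294`; top label `j = 53 = l⋆`: `d = 589,680`, floor-free price `340,972`, `ρ₅₃ = 881`, `price = 341,853`, `margin₅₃ = −247,827`. [folklore] -/
theorem workedPlace_cells :
    demand 210 31 = 201600 ∧ price 1605 210 31 1604 268 (-4472) = 202069 ∧
    demand 210 32 = 214830 ∧ price 1605 210 32 1604 268 (-4472) = 208536 ∧
    demand 210 53 = 589680 ∧ price 1605 210 53 1604 268 (-4472) = 341853 ∧
    (53 : ℤ) * 1604 + 54 * (268 - (-4472)) = 340972 ∧ ((53 : ℤ) ^ 2 * 210 - 53 * 1604 - (53 + 1) * 268) % 1605 = 881 ∧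
    price 1605 210 31 1604 268 (-4472) - demand 210 31 = 469 ∧
    price 1605 210 32 1604 268 (-4472) - demand 210 32 = -6294 ∧
    price 1605 210 53 1604 268 (-4472) - demand 210 53 = -247827 := by
  unfold price demand
  decide

/-- **Licence status of the three cells** (`HullCellδ ⟺ demand ≤ price`, `hullCellδ_iff_demand_le_price'`): label `31` LICENSED, labels `32` and `53` NOT — the sheet's
licence boundary `j₀ = 31`. [folklore] -/
theorem workedPlace_licence :
    HullCellδ 1605 210 31 1604 268 (-4472) ∧ ¬ HullCellδ 1605 210 32 1604 268 (-4472) ∧ ¬ HullCellδ 1605 210 53 1604 268 (-4472) := by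
  simp only [hullCellδ_iff_demand_le_price']
  unfold price demand
  decide

/-- **C5 · the place's MASSES in closed form** (`six_mul_sum_demand_eq'`, BY NAME): `S₂(31) := Σ_{j ≤ 31}(j² − 1) = 10,385`, `LL = S₂(31)·210 = 2,180,850` (licensed mass),
`MM = S₂(53)·210 = 10,707,060`, `UM = MM − LL = 8,526,210`. [folklore] -/
theorem workedPlace_masses :
    ∑ k ∈ range 31, demand 1 (1 + (k : ℤ)) = 10385 ∧ ∑ k ∈ range 31, demand 210 (1 + (k : ℤ)) = 2180850 ∧
    ∑ k ∈ range 53, demand 210 (1 + (k : ℤ)) = 10707060 ∧ (10707060 : ℤ) - 2180850 = 8526210 := by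
  have h1 := six_mul_sum_demand_eq' 1 31; have h2 := six_mul_sum_demand_eq' 210 31; have h3 := six_mul_sum_demand_eq' 210 53
  push_cast at h1 h2 h3
  omega

/-- **C3/C5 · the place's RATIOS, EXACT**: as-posed `x*_w = (DD − CC)/UM = (2,471,121 − 1,138,639)/8,526,210 = 0.156280…`; LIC `x*°_w = 1 − CC/UM = 0.866454…`; CONTAINER CAP
`x_cap(w) = price₅₃/d₅₃ = 341,853/589,680 = 1 − 247,827/589,680 = 0.579726…` < the `j = 32` ratio `1 − 6,294/214,830 = 0.970702…` («the cap binds at the TOP label»). [folklore] -/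
theorem workedPlace_ratios :
    ((2471121 : ℚ) - 1138639) / 8526210 = 1332482 / 8526210 ∧ (156280 : ℚ) / 10 ^ 6 < 1332482 / 8526210 ∧ (1332482 : ℚ) / 8526210 < 156281 / 10 ^ 6 ∧
    (1 : ℚ) - 1138639 / 8526210 = 7387571 / 8526210 ∧ (866454 : ℚ) / 10 ^ 6 < 7387571 / 8526210 ∧ (7387571 : ℚ) / 8526210 < 866455 / 10 ^ 6 ∧
    (341853 : ℚ) / 589680 = 1 - 247827 / 589680 ∧ (579726 : ℚ) / 10 ^ 6 < 341853 / 589680 ∧ (341853 : ℚ) / 589680 < 579727 / 10 ^ 6 ∧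
    (208536 : ℚ) / 214830 = 1 - 6294 / 214830 ∧ (341853 : ℚ) / 589680 < 208536 / 214830 := by
  norm_num

/-- **C4/C5 · THE CONTAINER CAP of the worked place, EXACT** (`V3_B2_containerConsistent`, p539557, over ALL labels `2 ≤ j ≤ 53 = l⋆`): a UNIFORM relaxation fraction `x` stays
inside print's own container at this place IFF `x ≤ x_cap(w) = 341,853/589,680` — the minimum of `price_j/d_j` over the 22 unlicensed labels `32 … 53` sits at the TOP label
(decided label by label in the kernel); beyond it «all of the lift is volume BEYOND print's container» = the census's KILLED-BY-CONSISTENCY locus. [folklore] -/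
theorem containerConsistent_workedPlace_iff (x : ℚ) :
    V3_B2_containerConsistent x 1605 210 1604 268 (-4472) 53 ↔ x ≤ 341853 / 589680 := by
  refine ⟨fun h => ?_, fun hx j hj2 hjL hnot => ?_⟩
  · have h53 := h 53 (by norm_num) (by norm_num) workedPlace_licence.2.2
    have hd : ((demand 210 53 : ℤ) : ℚ) = 589680 := by exact_mod_cast workedPlace_cells.2.2.2.2.1
    have hp : ((price 1605 210 53 1604 268 (-4472) : ℤ) : ℚ) = 341853 := by exact_mod_cast workedPlace_cells.2.2.2.2.2.1
    rw [hd, hp] at h53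
    rwa [le_div_iff₀ (by norm_num)]
  · have hall : ∀ j ∈ Finset.Icc (2 : ℤ) 53, ¬ (demand 210 j ≤ price 1605 210 j 1604 268 (-4472)) →
        341853 * demand 210 j ≤ 589680 * price 1605 210 j 1604 268 (-4472) := by
      unfold price demand
      decide
    have hjL' : j ≤ 53 := by exact_mod_cast hjL
    have hj := hall j (Finset.mem_Icc.mpr ⟨hj2, hjL'⟩) (by rwa [hullCellδ_iff_demand_le_price'] at hnot)
    have hjQ : (341853 : ℚ) * (demand 210 j : ℚ) ≤ 589680 * (price 1605 210 j 1604 268 (-4472) : ℚ) := by exact_mod_cast hj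
    have hd0 : (0 : ℚ) ≤ (demand 210 j : ℚ) := by exact_mod_cast demand_nonneg (by norm_num) (by linarith)
    nlinarith

/-- **INSIDE THE CAP the relaxation is cell-wise BELOW tier EX** (sheet C4; census «CONSISTENT-and-booked inside it (≤ tier EX)»): under `V3_B2_containerConsistent x …` the
relaxed LIC slack `−d_j + x·d_j` of an unlicensed cell is at most its exact (EX) slack `−d_j + price_j`. [folklore] -/
theorem relaxedSlack_le_exactSlack_of_containerConsistent {x : ℚ} {e m δ rin rout : ℤ} {L : ℕ}
    (h : V3_B2_containerConsistent x e m δ rin rout L) {j : ℤ} (hj2 : 2 ≤ j) (hjL : j ≤ L) (hnot : ¬ HullCellδ e m j δ rin rout) :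
    -(demand m j : ℚ) + x * (demand m j : ℚ) ≤ -(demand m j : ℚ) + (price e m j δ rin rout : ℚ) := by
  linarith [h j hj2 hjL hnot]

section V3Kernel

variable {T : ThetaIndex} {S : Situation T} {P : Cor312.Setting S}

/-- **«x = 1 IS THE STATEMENT»** (sheet C6 «B1 with constant x … CLOSES only at x = 1, where ŝ₁ = κ ≥ 0 on every cell and (P) keeps everything»): the residual door
`V3_B1_coneRelaxedBy P κ 1` (p539557) with `κ ≥ 0` puts every unlicensed cell's deficit `≤ −κ ≤ 0`; licensed cells are `≤ 0` (`cellDeficit_nonpos_of_mem_licenceCells`, p476178);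
so `D(P) ≤ 0`, which IS the printed Statement (`statement_iff_signedRemainder_nonpos`, p480491). «follows AS TYPED», nothing asserted. [claim: Mochizuki2012, status: disputed] -/
theorem statement_of_coneRelaxedBy_one (H : BridgeHyps P) {κ : Fin T.lstar × T.VQ → ℝ} (hκ : ∀ c, 0 ≤ κ c)
    (h : V3_B1_coneRelaxedBy P κ 1) : P.Statement := by
  rw [statement_iff_signedRemainder_nonpos H]
  have hcell : ∀ c : Fin T.lstar × T.VQ, cellDeficit P c.1 c.2 ≤ 0 := fun c => by
    by_cases hc : c ∈ licenceCells P
    · exact cellDeficit_nonpos_of_mem_licenceCells H hc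
    · have := h c hc
      rw [sub_self, zero_mul, zero_sub] at this
      linarith [hκ c]
  have hfib : ∀ i : Fin T.lstar, ∑ᶠ vQ : T.VQ, cellDeficit P i vQ ≤ 0 := fun i => by
    have h0 : 0 ≤ ∑ᶠ vQ : T.VQ, -cellDeficit P i vQ := finsum_nonneg fun vQ => neg_nonneg.mpr (hcell (i, vQ))
    rw [finsum_neg_distrib] at h0
    exact neg_nonneg.mp h0
  unfold signedRemainder processionNormalized
  exact div_nonpos_of_nonpos_of_nonneg (Finset.sum_nonpos fun i _ => hfib i) (Nat.cast_nonneg _)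

end V3Kernel

/-- **V3 on the HEIGHT AXIS — for every FIXED `x < 1` the relaxed certificate is still `s`-free** (sheet C6 «the relaxed tiers inherit the class laws of rows 3/5 … with the
financing constant multiplied by 1/(1−x) … EXPONENT-INERT»): dividing a `PriceBounded` profile (p532994) by `1 − x > 0` gives a `PriceBounded` profile. [folklore] -/
theorem priceBounded_coneRelax {M₁ x : ℝ} (hx : x < 1) {f : ℝ → ℝ} (hf : PriceBounded M₁ f) :
    PriceBounded M₁ (fun s => f s / (1 - x)) := by
  obtain ⟨cert, Pbar, hcert, hf⟩ := hf
  refine ⟨fun s => cert s / (1 - x), Pbar / (1 - x), fun s hs => div_le_div_of_nonneg_right (hcert s hs) (by linarith), fun s hs => ?_⟩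
  simp only [hf s hs]
  ring

/-- … hence exponent `−1` (`negExponent_of_priceBounded`, BY NAME) … [folklore] -/
theorem negExponent_coneRelax {M₁ x : ℝ} (hM : 0 < M₁) (hx : x < 1) {f : ℝ → ℝ} (hf : PriceBounded M₁ f) :
    NegExponent (fun s => f s / (1 - x)) :=
  negExponent_of_priceBounded hM (priceBounded_coneRelax hx hf)

/-- … and NO DOOR for any fixed `x < 1` (`not_doorAt_of_negExponent`, BY NAME): census «exponent-inert on the height axis (x*(s) → 1; closes only at x = 1 = the Statement)».
[folklore] -/
theorem not_doorAt_coneRelax {M₁ x : ℝ} (hM : 0 < M₁) (hx : x < 1) {f : ℝ → ℝ} (hf : PriceBounded M₁ f) :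
    ¬ DoorAt (fun s => f s / (1 - x)) :=
  not_doorAt_of_negExponent (negExponent_coneRelax hM hx hf)

/-! ## §V5 (census O-14) — PLACE AGGREGATION. Word of record: KILLED-BY-CONSISTENCY (weights beyond degree) / KILLED-BY-DATA as an instrument (dropping is dominated); LIVE
only as «V^bad_mod is a choice»; residual `V5_R2_droppedShareBound` (p540469). Per place: mass `MM_w`, certified `K_w ≤ MM_w` (`= min(MM_w, PP_w)` at L1a, `BedOptimum.value_eq_min`). -/

section V5Table

variable {α 𝕜 : Type*} [Field 𝕜] [LinearOrder 𝕜] [IsStrictOrderedRing 𝕜]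

/-- **THE LAW BEHIND kept@1 — a retained sub-datum MEETS `μ₀ = 1` iff every kept place is SELF-FINANCING** (`K_w = MM_w`, tst-1 «⟺ CC_w ≥ DD_w»): `Σ_{w∈S} MM_w ≤ Σ_{w∈S} K_w
⟺ ∀ w ∈ S, K_w = MM_w` — termwise-dominated sums meet only termwise. [folklore] -/
theorem meets_one_iff_forall_selfFinancing {S : Finset α} {K MM : α → 𝕜} (hK : ∀ w ∈ S, K w ≤ MM w) :
    ∑ w ∈ S, MM w ≤ ∑ w ∈ S, K w ↔ ∀ w ∈ S, K w = MM w :=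
  ⟨fun h => (Finset.sum_eq_sum_iff_of_le hK).mp (le_antisymm (Finset.sum_le_sum hK) h),
    fun h => (Finset.sum_congr rfl fun w hw => (h w hw).symm).le⟩

/-- **«keepable share@1 = mass share of the self-financing places» — the closed form behind the recounts `818/1,014 · 482/509 · 2,952/3,392`** (sheet (c2) «holds on 1,396/1,396
rows»; referee ✓): a place set `S ⊆ W` whose retained sub-datum MEETS `μ₀ = 1` carries at most the mass of ALL self-financing places (`selfFinancing_meets_one` attains it). [folklore] -/
theorem keepable_le_selfFinancingMass {W S : Finset α} {K MM : α → 𝕜} (hSW : S ⊆ W) (hK : ∀ w ∈ W, K w ≤ MM w)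
    (hM : ∀ w ∈ W, 0 ≤ MM w) (hmeet : ∑ w ∈ S, MM w ≤ ∑ w ∈ S, K w) :
    ∑ w ∈ S, MM w ≤ ∑ w ∈ W.filter (fun w => K w = MM w), MM w := by
  refine Finset.sum_le_sum_of_subset_of_nonneg (fun w hw => Finset.mem_filter.mpr ⟨hSW hw, ?_⟩) fun w hw _ => hM w (Finset.mem_filter.mp hw).1
  exact ((meets_one_iff_forall_selfFinancing fun w' hw' => hK w' (hSW hw')).mp hmeet) w hw

omit [IsStrictOrderedRing 𝕜] in
/-- The self-financing place set itself MEETS `μ₀ = 1` (with equality): kept `818 | 482 | 2,952` places, dropped `196 | 27 | 440` = the AXIS-D1 budget-bound places. [folklore] -/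
theorem selfFinancing_meets_one {W : Finset α} (K MM : α → 𝕜) :
    ∑ w ∈ W.filter (fun w => K w = MM w), MM w = ∑ w ∈ W.filter (fun w => K w = MM w), K w :=
  Finset.sum_congr rfl fun _ hw => ((Finset.mem_filter.mp hw).2).symm

omit [IsStrictOrderedRing 𝕜] in
/-- **The within-place netting row HOLDS on the self-financing places at print's weights `ω ≡ 1`, by definition** (`V2_B0'_netWithinPlace`, p539032, BY NAME): «dropping places makes
μ₀ = 1 reachable on every datum» TRIVIALLY (tst-1: «EVERY bed datum has ≥ 1 self-financing place»). [folklore] -/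
theorem netWithinPlace_selfFinancing {ι : Type*} (places : Finset α) (cells : α → Finset ι) (ŝ : ι → 𝕜) :
    V2_B0'_netWithinPlace (places.filter fun w => 0 ≤ ∑ c ∈ cells w, ŝ c) cells ŝ := fun w hw => by
  simpa only [one_mul] using (Finset.mem_filter.mp hw).2

/-- **DROPPING IS DOMINATED — it LOSES certified mass** (sheet «undropped 0.9086 | 0.9705 (0.9494) of M; dropped-to-MEET 0.6398 | 0.8160 (0.7635): LOSES 0.2688·M | 0.1545·M
(0.1859·M)»; census «KILLED-BY-DATA as an instrument»): the value certified on a kept sub-family `S ⊆ W` is at most the undropped one (`K_w ≥ 0`). [folklore] -/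
theorem dropped_certifies_le {W S : Finset α} {K : α → 𝕜} (hSW : S ⊆ W) (hK : ∀ w ∈ W, 0 ≤ K w) : ∑ w ∈ S, K w ≤ ∑ w ∈ W, K w :=
  Finset.sum_le_sum_of_subset_of_nonneg hSW fun w hw _ => hK w hw

/-- **RE-WEIGHTING NEVER BEATS THE BEST SINGLE PLACE** (sheet (c0) «the supremum over π ≥ 0 is max_w min(1, PP_w/MM_w) (a ratio of sums is maximised at one summand)»; tst-1
«any weights … give kept/counted ratio ≤ 1»): if `K_w ≤ r·MM_w` at every place then `Σ π_w K_w ≤ r·Σ π_w MM_w` for ALL `π ≥ 0`. [folklore] -/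
theorem reweight_le_bestRatio {S : Finset α} {K MM π : α → 𝕜} {r : 𝕜} (hπ : ∀ w ∈ S, 0 ≤ π w) (hr : ∀ w ∈ S, K w ≤ r * MM w) :
    ∑ w ∈ S, π w * K w ≤ r * ∑ w ∈ S, π w * MM w := by
  rw [Finset.mul_sum]
  exact Finset.sum_le_sum fun w hw => by
    rw [mul_left_comm]
    exact mul_le_mul_of_nonneg_left (hr w hw) (hπ w hw)

/-- **NO LOSS-FREE RELAXATION INSIDE V5** (sheet WORDS «μ(π) < 1 whenever one π_w > 0 sits on a budget-bound place, by separability»): with `K ≤ MM` termwise and one place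
with `π_w > 0 ∧ K_w < MM_w`, the re-weighted kept mass is STRICTLY below the re-weighted total. [folklore] -/
theorem reweight_lt_total_of_budgetBound {S : Finset α} {K MM π : α → 𝕜} (hπ : ∀ w ∈ S, 0 ≤ π w) (hK : ∀ w ∈ S, K w ≤ MM w)
    (hw : ∃ w ∈ S, 0 < π w ∧ K w < MM w) : ∑ w ∈ S, π w * K w < ∑ w ∈ S, π w * MM w :=
  let ⟨w₀, hw₀, hp, hk⟩ := hw; Finset.sum_lt_sum (fun w hw => mul_le_mul_of_nonneg_left (hK w hw) (hπ w hw)) ⟨w₀, hw₀, mul_lt_mul_of_pos_left hk hp⟩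

/-- **THE SHADOW-PRICE SIGN LAW** (sheet (c0) «∂μ/∂π_w = u_w·(min(MM_w,PP_w) − μ·MM_w)/M — POSITIVE at cap-bound, NEGATIVE at budget-bound places»; referee ✓), finite-increment
form: an extra weight `θ > 0` on a place `(k, m)` RAISES the pooled ratio iff that place beats it, `K/M < (K + θk)/(M + θm) ⟺ K·m < k·M` — it certifies nothing new. [folklore] -/
theorem reweight_gain_iff {K M k m θ : 𝕜} (hM : 0 < M) (hm : 0 < m) (hθ : 0 < θ) :
    K / M < (K + θ * k) / (M + θ * m) ↔ K * m < k * M := by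
  rw [div_lt_div_iff₀ hM (by positivity)]
  have e1 : K * (M + θ * m) = K * M + θ * (K * m) := by ring
  have e2 : (K + θ * k) * M = K * M + θ * (k * M) := by ring
  rw [e1, e2, add_lt_add_iff_left]
  exact ⟨fun h => lt_of_mul_lt_mul_left h hθ.le, fun h => mul_lt_mul_of_pos_left h hθ⟩

/-- **THE BED RECOUNTS of record, as arithmetic** (rh-ref-1 14:34:51Z: kept `818 (b 829)/1,014 | 482/509 | 2,952/3,392` ⇒ dropped `196 | 27 | 440`; losses `0.9085688818 −
0.6397735998 = 0.2687952820`, `0.9705400551 − 0.8160214200 = 0.1545186351`, `0.9494147156 − 0.7635200723 = 0.1858946433`): computed ≠ proved — re-added only. [folklore] -/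
theorem bed_recounts :
    818 + 196 = 1014 ∧ 829 + 185 = 1014 ∧ 482 + 27 = 509 ∧ 2952 + 440 = 3392 ∧ (9085688818 : ℚ) / 10 ^ 10 - 6397735998 / 10 ^ 10 = 2687952820 / 10 ^ 10 ∧
    (9705400551 : ℚ) / 10 ^ 10 - 8160214200 / 10 ^ 10 = 1545186351 / 10 ^ 10 ∧
    (9494147156 : ℚ) / 10 ^ 10 - 7635200723 / 10 ^ 10 = 1858946433 / 10 ^ 10 := by
  norm_num

end V5Table

section V5Setting

variable {T : ThetaIndex} {S : Situation T} (P : Cor312.Setting S)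

/-- **CONSTANT PLACE WEIGHTS ARE INERT — mass side**: `reweightedMass P (π ≡ c) = c·M` (p540469; at `c = 1` L5-t8's `reweightedMass_one`). The sheet's typed obstruction
`V5_R1_degreeRigidity` says the degree formalism admits only CONSTANT place weights; this and the next two theorems say constants change nothing. [claim: Mochizuki2012, status: disputed] -/
theorem reweightedMass_const (c : ℝ) : reweightedMass P (fun _ => c) = c * totalTrivialMass P := by
  unfold reweightedMass totalTrivialMass processionNormalized
  simp_rw [← mul_finsum]
  rw [← Finset.mul_sum, mul_div_assoc]

/-- **CONSTANT PLACE WEIGHTS ARE INERT — excess side**: `reweightedExcess P (π ≡ c) = c·reweightedExcess P (π ≡ 1)` (p540469). [claim: Mochizuki2012, status: disputed] -/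
theorem reweightedExcess_const (c : ℝ) : reweightedExcess P (fun _ => c) = c * reweightedExcess P (fun _ => 1) := by
  unfold reweightedExcess processionNormalized
  simp_rw [one_mul, ← mul_finsum]
  rw [← Finset.mul_sum, mul_div_assoc]

/-- **CONSTANT PLACE WEIGHTS ARE INERT — the requirement**: for `c > 0`, `V5_R1_reweightedCor312 P (π ≡ c) ⟺ V5_R1_reweightedCor312 P (π ≡ 1)` (= print's `M ≤ excess`): the
census's «E unchanged». [claim: Mochizuki2012, status: disputed] -/
theorem reweightedCor312_const_iff {c : ℝ} (hc : 0 < c) :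
    V5_R1_reweightedCor312 P (fun _ => c) ↔ V5_R1_reweightedCor312 P (fun _ => 1) := by
  unfold V5_R1_reweightedCor312
  rw [reweightedMass_const, reweightedExcess_const P c, reweightedMass_one]
  exact ⟨fun h => le_of_mul_le_mul_left h hc, fun h => mul_le_mul_of_nonneg_left h hc.le⟩

end V5Setting

/-- **THE DROPPED SHARE IS A HEIGHT-INERT POSITIVE CONSTANT** (sheet R-V5-2: the payment `V5_R2_droppedShareBound S B` (p540469) needs `B` HEIGHT-SUBLINEAR — «a partial Szpiro
inequality at the dropped places»): on the dilation ray the dropped mass is `s·D₁` of `s·M₁` (`demand_dilate`), a `DoorAt` profile (`doorAt_transfer_iff`): exponent `0`. [folklore] -/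
theorem droppedShare_doorAt {D₁ M₁ : ℝ} (hD : 0 < D₁) (hM : 0 < M₁) : DoorAt (fun s => s * D₁ / (s * M₁)) :=
  (doorAt_transfer_iff hM).mpr hD

/-- … in particular the dropped fraction has NO negative exponent (`not_doorAt_of_negExponent`, contraposed): a height-sublinear `B` in `V5_R2_droppedShareBound` is never the
window model's own dropped mass. [folklore] -/
theorem droppedShare_not_negExponent {D₁ M₁ : ℝ} (hD : 0 < D₁) (hM : 0 < M₁) : ¬ NegExponent (fun s => s * D₁ / (s * M₁)) := fun h =>
  not_doorAt_of_negExponent h (droppedShare_doorAt hD hM)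

end Summit.ABC.IUTFork.Repair.RH.Round4ConstraintFacesOdd

end
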